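import Literature.AlgebraicGeometry.Resolution.HenselizationHenselian
import Literature.AlgebraicGeometry.Resolution.ValuationConjugacyNormal
import Literature.AlgebraicGeometry.Resolution.SmoothUniformization
import Mathlib.FieldTheory.AlgebraicClosure
import Mathlib.FieldTheory.PurelyInseparable.Tower
import HarnessLib

/-!
# The henselization: decomposition group in `Aut(K̃/K)` and the degree formula `∑ [K^h·ι(L) : K^h] = [L : K]`

Topic: `Literature/AlgebraicGeometry/Resolution` (valued function fields). PROVED Galois-theoretic
half of the discharge of the named fact `Kuhlmann2010DefectlessIffHenselization`
(`Henselization.lean`) = F.-V. Kuhlmann, *Elimination of ramification I: The generalized stability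
theorem*, Trans. AMS 362 (2010) = arXiv:1003.5678, **Thm. 2.14**: "Take a valued field `(K,v)` and
fix an extension of `v` to `K̃`. Then `(K,v)` is defectless if and only if its henselization
`(K,v)^h` in `(K̃,v)` is defectless." The source proves it by reference ("[En], Theorem (18.2) …
See [K6] for more details"); the classical proof (O. Endler, *Valuation theory* (1972), §17–18)
rests on the **degree formula**: for a finite extension `L|K` with extensions `v₁, …, v_g` of `v`,
realised inside `K̃` by `K`-embeddings `ι₁, …, ι_g` of `L`,

  `[L : K] = ∑ᵢ [K^h·ιᵢ(L) : K^h]`,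

because the extensions of `v` to `L` correspond to the orbits of `Gal(K̃ | K^h)` (the
decomposition group) on the `K`-embeddings `L → K̃`. This file proves the formula in the
ambient rendering of `Henselization.lean` (one algebraically closed valued field `(Ω, V)`, `K ≤ Ω`,
`K^h = henselization V K ⊆ K^sep ⊆ K̃ ⊆ Ω`), for an abstract finite extension `L` of `K`
(`[Algebra K L] [FiniteDimensional K L]`) and its `K`-embeddings `ι : L →ₐ[K] Ω`:

* `exists_algEquiv_comp_eq` — transitivity of `Aut(E/F)` on the `F`-embeddings of a field into a
  normal extension `E`; `smul_valuationSubring_eq_self_iff`.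
* `smul_comap_algebraicClosure_eq_iff` — **the decomposition group at the level of `K̃`**: a
  `K`-automorphism `σ` of `K̃ = algebraicClosure K Ω` satisfies `σ(V ∩ K̃) = V ∩ K̃` iff `σ` fixes
  `K^h` pointwise (restriction to `K^sep`, where `Gal(K^sep | K^h)` IS the decomposition group —
  `mem_decompositionGroup_of_forall_apply_eq`, `HenselizationHenselian.lean` —; `K̃ | K^sep` is
  purely inseparable, `x ∈ W ↔ x^m ∈ W`).
* `exists_algHom_comap_eq` — every valuation ring of `L` over `V ∩ K` is `ι⁻¹(V)` for some
  `K`-embedding `ι : L → Ω` (Chevalley extension + conjugacy in `K̃`, `exists_smul_eq_of_normal` of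
  `ValuationConjugacyNormal.lean`).
* `exists_algEquiv_apply_eq_of_comap_eq` — `ι, ι'` induce the same valuation ring iff they differ by
  an automorphism of `K̃` fixing `K^h` (conjugacy over `ι(L)`); whence, with
  `M_ι = K^h(ι(L)) = IntermediateField.adjoin (henselization V K) (Set.range (ι ∘ b))` for a
  `K`-basis `b` of `L` (`algHom_apply_mem_adjoin`, `finiteDimensional_adjoin_henselization`,
  `coe_adjoin_mem_algebraicClosure`): `exists_algHom_adjoin_apply_eq`,
  `algHom_adjoin_apply_mem_iff`, `algHom_adjoin_ext` and **`natCard_fiber_eq_natCard_algHom`**: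
  `#{ι' : ι'⁻¹(V) = ι⁻¹(V)} = #Hom_{K^h}(M_ι, Ω)`.
* `isAlgebraic_henselization`, `isSeparable_henselization` (`K^h | K` separable-algebraic),
  `finInsepDegree_adjoin_eq` (`[M_ι : K^h]_i = [L : K]_i`, by Mathlib's tower laws for the
  inseparable degree), `finrank_adjoin_eq` (`[M_ι : K^h] = #Hom_{K^h}(M_ι, Ω) · [L : K]_i`).
* `sum_finrank_adjoin_eq_finrank` — **the degree formula**: if `s` is the set of valuation rings of
  `L` over `V ∩ K` and `ι_{O'}` induces `O' ∈ s`, then `∑_{O' ∈ s} [M_{ι_{O'}} : K^h] = [L : K]`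
  (count the `[L : K]_s` embeddings `L → Ω` according to the valuation ring they induce).

## Sources

* F.-V. Kuhlmann, Trans. AMS 362 (2010) = arXiv:1003.5678, §1.1 (henselization = decomposition
  field; conjugacy of the extensions), Lemma 2.2 (`K^h|K` separable-algebraic), Thm. 2.14.
* O. Endler, *Valuation theory*, Springer 1972, §17 (the degree formula), Thm. (18.2) — the
  reference given by the source (not held; classical).

## Rendering notes

* `K̃ = algebraicClosure K Ω` and `K^sep = separableClosure K Ω` are `IntermediateField K Ω`; the
  henselization enters as the subfield `henselization V K` (an `E`-algebra and a subalgebra of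
  `Ω` by `Henselization.lean`), over which `IntermediateField.adjoin` is taken. No definitions.
-/

noncomputable section

open IsLocalRing
open scoped Pointwise

namespace Literature.AlgebraicGeometry.Resolution

universe u

/-! ### Generalities -/

section General

variable {F E : Type*} [Field F] [Field E] [Algebra F E]

/-- `Aut(E/F)` acts transitively on the `F`-embeddings of a field into a normal extension
`E/F`: two `F`-algebra maps `φ ψ : M → E` differ by an automorphism of `E`. [folklore] -/
theorem exists_algEquiv_comp_eq [Normal F E] {M : Type*} [Field M] [Algebra F M]
    (φ ψ : M →ₐ[F] E) : ∃ τ : E ≃ₐ[F] E, ∀ m, τ (φ m) = ψ m := by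
  let M₁ : IntermediateField F E := φ.fieldRange
  let e : M ≃ₐ[F] M₁ := AlgEquiv.ofInjectiveField φ
  let χ : M₁ →ₐ[F] E := ψ.comp e.symm.toAlgHom
  let τ₀ : E →ₐ[F] E := χ.liftNormal E
  refine ⟨AlgEquiv.ofBijective τ₀ (AlgHom.normal_bijective F E E τ₀), fun m => ?_⟩
  have h1 : φ m = algebraMap M₁ E (e m) := rfl
  rw [AlgEquiv.ofBijective_apply, h1]
  change χ.liftNormal E (algebraMap M₁ E (e m)) = ψ m
  rw [AlgHom.liftNormal_commutes]
  change ψ (e.symm (e m)) = ψ m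
  rw [AlgEquiv.symm_apply_apply]

/-- `σ(W) = W` iff `σ` preserves membership in `W`. [folklore] -/
theorem smul_valuationSubring_eq_self_iff (σ : E ≃ₐ[F] E) (W : ValuationSubring E) :
    σ • W = W ↔ ∀ z : E, σ z ∈ W ↔ z ∈ W := by
  constructor
  · intro h z
    conv_lhs => rw [← h]
    exact apply_mem_smul_valuationSubring_iff σ W z
  · intro h
    ext y
    rw [mem_smul_valuationSubring_iff, ← h (σ.symm y), AlgEquiv.apply_symm_apply]

end General

/-! ### The decomposition group at the level of the algebraic closure `K̃ ⊆ Ω` -/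

section Ambient

variable {Ω : Type u} [Field Ω] [IsAlgClosed Ω] (V : ValuationSubring Ω) (K : Subfield Ω)

omit [IsAlgClosed Ω] in
/-- `K^sep ⊆ K̃` inside `Ω`. [folklore] -/
theorem separableClosure_le_algebraicClosure :
    separableClosure (K : Subfield Ω) Ω ≤ algebraicClosure K Ω := fun _ hx =>
  mem_algebraicClosure_iff.mpr (mem_separableClosure_iff.mp hx).isIntegral.isAlgebraic

omit [IsAlgClosed Ω] in
/-- `K^h ⊆ K̃` inside `Ω`. [folklore] -/
theorem henselization_le_algebraicClosure :
    henselization V K ≤ (algebraicClosure K Ω).toSubfield := fun _ hx =>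
  separableClosure_le_algebraicClosure K (henselization_le_separableClosure V K hx)

/-- **The decomposition group at the level of `K̃`.** For a `K`-automorphism `σ` of the
algebraic closure `K̃` of `K` in `Ω`: `σ` maps the valuation ring `V ∩ K̃` onto itself iff
`σ` fixes the henselization `K^h` pointwise. (`⇒`: the restriction of `σ` to `K^sep` lies
in the decomposition group, whose fixed field is `K^h`; `⇐`: the restriction fixes `K^h`,
hence lies in `Gal(K^sep | K^h)`, which is the decomposition group because the latter is
closed (`mem_decompositionGroup_of_forall_apply_eq`, `HenselizationHenselian.lean`); so `σ`
preserves `V ∩ K^sep`, hence `V ∩ K̃` by purely inseparable uniqueness, `x ∈ W ↔ x^{p^n} ∈ W`.)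
PROVED. [cite: Kuhlmann2010, Section 1.1] -/
theorem smul_comap_algebraicClosure_eq_iff
    (σ : (algebraicClosure K Ω) ≃ₐ[K] (algebraicClosure K Ω)) :
    σ • V.comap (algebraMap (algebraicClosure K Ω) Ω) =
        V.comap (algebraMap (algebraicClosure K Ω) Ω) ↔
      ∀ x : algebraicClosure K Ω, (x : Ω) ∈ henselization V K → σ x = x := by
  have hNA : separableClosure K Ω ≤ algebraicClosure K Ω :=
    separableClosure_le_algebraicClosure K
  letI : Algebra (separableClosure K Ω) (algebraicClosure K Ω) :=
    (IntermediateField.inclusion hNA).toRingHom.toAlgebra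
  haveI : IsScalarTower K (separableClosure K Ω) (algebraicClosure K Ω) :=
    IsScalarTower.of_algebraMap_eq fun _ => rfl
  let σN : (separableClosure K Ω) ≃ₐ[K] (separableClosure K Ω) :=
    σ.restrictNormal (separableClosure K Ω)
  have hσN : ∀ y : separableClosure K Ω, ((σN y : separableClosure K Ω) : Ω) =
      ((σ (algebraMap (separableClosure K Ω) (algebraicClosure K Ω) y) :
        algebraicClosure K Ω) : Ω) := fun y =>
    congrArg (fun z : algebraicClosure K Ω => (z : Ω))
      (AlgEquiv.restrictNormal_commutes σ (separableClosure K Ω) y)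
  have hσNsymm : ∀ y : separableClosure K Ω,
      σ.symm (algebraMap (separableClosure K Ω) (algebraicClosure K Ω) y) =
        algebraMap (separableClosure K Ω) (algebraicClosure K Ω) (σN.symm y) := by
    intro y
    rw [AlgEquiv.symm_apply_eq]
    exact ((AlgEquiv.restrictNormal_commutes σ (separableClosure K Ω) (σN.symm y)).symm.trans
      (congrArg _ (AlgEquiv.apply_symm_apply σN y))).symm
  -- Step 1: `σ(V ∩ K̃) = V ∩ K̃ ↔ σN ∈ D`
  have key : σ • V.comap (algebraMap (algebraicClosure K Ω) Ω) =
      V.comap (algebraMap (algebraicClosure K Ω) Ω) ↔ σN ∈ decompositionGroup V K := by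
    rw [mem_decompositionGroup_iff]
    constructor
    · intro h
      rw [smul_valuationSubring_eq_self_iff] at h ⊢
      intro z
      rw [mem_sepClosureValuationSubring_iff, mem_sepClosureValuationSubring_iff, hσN z]
      have := h (algebraMap (separableClosure K Ω) (algebraicClosure K Ω) z)
      rw [ValuationSubring.mem_comap, ValuationSubring.mem_comap] at this
      exact this
    · intro h
      -- purely inseparable uniqueness through `K̃ / K^sep`: `a ∈ W ↔ a^m ∈ W`, `a^m ∈ K^sep`
      ext a
      obtain ⟨m, hm, ham⟩ := exists_pow_mem_separableClosure K
        (mem_algebraicClosure_iff'.mp a.2)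
      rw [valuationSubring_mem_iff_pow_mem
          (σ • V.comap (algebraMap (algebraicClosure K Ω) Ω)) hm,
        valuationSubring_mem_iff_pow_mem (V.comap (algebraMap (algebraicClosure K Ω) Ω)) hm]
      have hy : a ^ m = algebraMap (separableClosure K Ω) (algebraicClosure K Ω)
          ⟨(a : Ω) ^ m, ham⟩ := Subtype.ext rfl
      rw [hy, mem_smul_valuationSubring_iff, hσNsymm, ValuationSubring.mem_comap,
        ValuationSubring.mem_comap]
      change ((σN.symm _ : separableClosure K Ω) : Ω) ∈ V ↔
        ((⟨(a : Ω) ^ m, ham⟩ : separableClosure K Ω) : Ω) ∈ V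
      rw [← mem_sepClosureValuationSubring_iff V K, ← mem_sepClosureValuationSubring_iff V K,
        ← mem_smul_valuationSubring_iff, h]
  rw [key]
  -- Step 2: `σN ∈ D ↔ σ fixes K^h`
  constructor
  · intro hD x hx
    obtain ⟨hxN, hfix⟩ := (mem_henselization_iff V K).mp hx
    have h1 : x = algebraMap (separableClosure K Ω) (algebraicClosure K Ω) ⟨x, hxN⟩ :=
      Subtype.ext rfl
    have h2 := hfix σN hD
    rw [h1]
    apply Subtype.ext
    rw [← hσN, h2]
    rfl
  · intro hfix
    refine mem_decompositionGroup_of_forall_apply_eq V K σN fun y hy => ?_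
    have := hfix (algebraMap (separableClosure K Ω) (algebraicClosure K Ω) y) hy
    apply Subtype.ext
    rw [hσN y, this]
    rfl

end Ambient

/-! ### `K`-embeddings of a finite extension and the valuation rings they induce -/

section Embeddings

variable {Ω : Type u} [Field Ω] [IsAlgClosed Ω] (V : ValuationSubring Ω) (K : Subfield Ω)
variable {L : Type u} [Field L] [Algebra K L]

omit [IsAlgClosed Ω] in
/-- A `K`-embedding of an algebraic extension lands in `K̃`. [folklore] -/
theorem algHom_apply_mem_algebraicClosure [Algebra.IsAlgebraic K L] (φ : L →ₐ[K] Ω) (y : L) :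
    φ y ∈ algebraicClosure K Ω :=
  mem_algebraicClosure_iff.mpr ((Algebra.IsAlgebraic.isAlgebraic (R := K) y).algHom φ)

/-- **Every extension of `V ∩ K` to a finite extension `L` of `K` is induced by a
`K`-embedding `L → Ω`** (existence of extensions of valuation rings + conjugacy in `K̃`).
PROVED. [cite: Kuhlmann2010, Section 1.1] -/
theorem exists_algHom_comap_eq [FiniteDimensional K L] (O' : ValuationSubring L)
    (hO' : O'.comap (algebraMap K L) = V.comap (algebraMap K Ω)) :
    ∃ ι : L →ₐ[K] Ω, V.comap ι.toRingHom = O' := by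
  haveI : IsAlgClosed (algebraicClosure K Ω) := IsAlgClosure.isAlgClosed K
  let ι₀ : L →ₐ[K] algebraicClosure K Ω := IsAlgClosed.lift (M := algebraicClosure K Ω)
  letI : Algebra L (algebraicClosure K Ω) := ι₀.toRingHom.toAlgebra
  obtain ⟨W, hW⟩ := exists_valuationSubring_comap_eq (F := L) (Ω := algebraicClosure K Ω) O'
  have hW' : ∀ y : L, ι₀ y ∈ W ↔ y ∈ O' := fun y => by
    rw [← hW]
    rfl
  have hWK : (V.comap (algebraMap (algebraicClosure K Ω) Ω)).comap
      (algebraMap K (algebraicClosure K Ω)) = W.comap (algebraMap K (algebraicClosure K Ω)) := by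
    ext c
    change (c : Ω) ∈ V ↔ algebraMap K (algebraicClosure K Ω) c ∈ W
    rw [← ι₀.commutes c, hW' (algebraMap K L c)]
    have := SetLike.ext_iff.mp hO' c
    exact this.symm
  obtain ⟨τ, hτ⟩ := exists_smul_eq_of_normal K _ W hWK
  refine ⟨(algebraicClosure K Ω).val.comp (τ.symm.toAlgHom.comp ι₀), ?_⟩
  ext y
  rw [ValuationSubring.mem_comap, ← hW' y, ← hτ, mem_smul_valuationSubring_iff]
  rfl

/-- Two `K`-embeddings `ι, ι'` of `L` inducing the SAME valuation ring differ by a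
`K`-automorphism of `K̃` fixing the henselization `K^h` pointwise (conjugacy over `ι(L)`, and
the decomposition group at the level of `K̃`). PROVED. [cite: Kuhlmann2010, Section 1.1] -/
theorem exists_algEquiv_apply_eq_of_comap_eq [FiniteDimensional K L] (ι ι' : L →ₐ[K] Ω)
    (h : V.comap ι.toRingHom = V.comap ι'.toRingHom) :
    ∃ σ : (algebraicClosure K Ω) ≃ₐ[K] (algebraicClosure K Ω),
      (∀ x : algebraicClosure K Ω, (x : Ω) ∈ henselization V K → σ x = x) ∧
      ∀ y : L, ((σ ⟨ι y, algHom_apply_mem_algebraicClosure K ι y⟩ : algebraicClosure K Ω) : Ω)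
        = ι' y := by
  haveI : IsAlgClosed (algebraicClosure K Ω) := IsAlgClosure.isAlgClosed K
  let ιA : L →ₐ[K] algebraicClosure K Ω := AlgHom.codRestrict ι
    (algebraicClosure K Ω).toSubalgebra (algHom_apply_mem_algebraicClosure K ι)
  let ι'A : L →ₐ[K] algebraicClosure K Ω := AlgHom.codRestrict ι'
    (algebraicClosure K Ω).toSubalgebra (algHom_apply_mem_algebraicClosure K ι')
  obtain ⟨τ, hτ⟩ := exists_algEquiv_comp_eq ιA ι'A
  -- `V ∩ K̃` and `τ⁻¹(V ∩ K̃)` agree on `ι(L)`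
  letI : Algebra L (algebraicClosure K Ω) := ιA.toRingHom.toAlgebra
  haveI : IsScalarTower K L (algebraicClosure K Ω) :=
    IsScalarTower.of_algebraMap_eq fun c => (ιA.commutes c).symm
  haveI : Algebra.IsAlgebraic L (algebraicClosure K Ω) := Algebra.IsAlgebraic.tower_top (K := K) L
  haveI : IsAlgClosure L (algebraicClosure K Ω) := ⟨inferInstance, inferInstance⟩
  have hcomap : (V.comap (algebraMap (algebraicClosure K Ω) Ω)).comap
      (algebraMap L (algebraicClosure K Ω)) =
      (τ⁻¹ • V.comap (algebraMap (algebraicClosure K Ω) Ω)).comap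
        (algebraMap L (algebraicClosure K Ω)) := by
    ext y
    change ιA y ∈ V.comap (algebraMap (algebraicClosure K Ω) Ω) ↔
      ιA y ∈ τ⁻¹ • V.comap (algebraMap (algebraicClosure K Ω) Ω)
    rw [mem_smul_valuationSubring_iff, ← AlgEquiv.aut_inv, inv_inv, hτ y]
    exact SetLike.ext_iff.mp h y
  obtain ⟨ρ, hρ⟩ := exists_smul_eq_of_normal L _ _ hcomap
  have hρK : (ρ.restrictScalars K) • V.comap (algebraMap (algebraicClosure K Ω) Ω) =
      ρ • V.comap (algebraMap (algebraicClosure K Ω) Ω) := by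
    ext x
    simp only [ValuationSubring.mem_smul_pointwise_iff_exists, AlgEquiv.smul_def,
      AlgEquiv.restrictScalars_apply]
  refine ⟨τ * ρ.restrictScalars K, ?_, fun y => ?_⟩
  · rw [← smul_comap_algebraicClosure_eq_iff, mul_smul, hρK, hρ, ← mul_smul, mul_inv_cancel,
      one_smul]
  · have h1 : (⟨ι y, algHom_apply_mem_algebraicClosure K ι y⟩ : algebraicClosure K Ω) =
        algebraMap L (algebraicClosure K Ω) y := rfl
    rw [h1, AlgEquiv.mul_apply, AlgEquiv.restrictScalars_apply, AlgEquiv.commutes]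
    exact congrArg (fun z : algebraicClosure K Ω => (z : Ω)) (hτ y)

end Embeddings

/-! ### The compositum `K^h(ι(L))` -/

section Compositum

variable {Ω : Type u} [Field Ω] [IsAlgClosed Ω] (V : ValuationSubring Ω) (K : Subfield Ω)
variable {L : Type u} [Field L] [Algebra K L] {n : ℕ} (b : Module.Basis (Fin n) K L)

omit [IsAlgClosed Ω] in
/-- `ι(L) ⊆ K^h(ι(L))`, the latter generated over `K^h` by the image of a `K`-basis `b` of `L`.
[folklore] -/
theorem algHom_apply_mem_adjoin (ι : L →ₐ[K] Ω) (y : L) :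
    ι y ∈ IntermediateField.adjoin (henselization V K) (Set.range (ι ∘ b)) := by
  have hy : y = ∑ i, b.repr y i • b i := (b.sum_repr y).symm
  rw [hy, map_sum]
  refine sum_mem fun i _ => ?_
  rw [map_smul, Algebra.smul_def]
  refine mul_mem ?_ (IntermediateField.subset_adjoin _ _ ⟨i, rfl⟩)
  have : algebraMap K Ω (b.repr y i) =
      algebraMap (henselization V K) Ω ⟨_, le_henselization V K (b.repr y i).2⟩ := rfl
  rw [this]
  exact IntermediateField.algebraMap_mem _ _

omit [IsAlgClosed Ω] in
/-- `K^h(ι(L))` is finite over `K^h`. [folklore] -/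
theorem finiteDimensional_adjoin_henselization [FiniteDimensional K L] (ι : L →ₐ[K] Ω) :
    FiniteDimensional (henselization V K)
      (IntermediateField.adjoin (henselization V K) (Set.range (ι ∘ b))) := by
  refine IntermediateField.finiteDimensional_adjoin fun x hx => ?_
  obtain ⟨i, rfl⟩ := hx
  exact ((Algebra.IsIntegral.isIntegral (R := K) (b i)).map ι).tower_top

omit [IsAlgClosed Ω] in
/-- `K^h / K` is algebraic. [folklore] -/
theorem isAlgebraic_henselization : Algebra.IsAlgebraic K (henselization V K) := by
  refine ⟨fun x => ?_⟩
  rw [← isAlgebraic_algHom_iff (IsScalarTower.toAlgHom K (henselization V K) Ω)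
    Subtype.val_injective]
  exact (isSeparable_of_mem_henselization V K x.2).isIntegral.isAlgebraic

omit [IsAlgClosed Ω] in
/-- `K^h(ι(L)) ⊆ K̃`. [folklore] -/
theorem coe_adjoin_mem_algebraicClosure [Algebra.IsAlgebraic K L] (ι : L →ₐ[K] Ω)
    (m : IntermediateField.adjoin (henselization V K) (Set.range (ι ∘ b))) :
    (m : Ω) ∈ algebraicClosure K Ω := by
  have hle : (IntermediateField.adjoin (henselization V K) (Set.range (ι ∘ b))).toSubfield ≤
      (algebraicClosure K Ω).toSubfield := by
    rw [IntermediateField.adjoin_toSubfield, Subfield.closure_le]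
    rintro x (⟨c, rfl⟩ | ⟨i, rfl⟩)
    · exact henselization_le_algebraicClosure V K c.2
    · exact algHom_apply_mem_algebraicClosure K ι _
  exact hle m.2

/-- Two `K`-embeddings `ι, ι'` of `L` inducing the same valuation ring: `ι'` extends to a
`K^h`-embedding of `K^h(ι(L))` into `Ω`. PROVED. [cite: Kuhlmann2010, Section 1.1] -/
theorem exists_algHom_adjoin_apply_eq [FiniteDimensional K L] (ι ι' : L →ₐ[K] Ω)
    (h : V.comap ι.toRingHom = V.comap ι'.toRingHom) :
    ∃ φ : IntermediateField.adjoin (henselization V K) (Set.range (ι ∘ b))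
        →ₐ[henselization V K] Ω,
      ∀ y : L, φ ⟨ι y, algHom_apply_mem_adjoin V K b ι y⟩ = ι' y := by
  obtain ⟨σ, hσfix, hσ⟩ := exists_algEquiv_apply_eq_of_comap_eq V K ι ι' h
  let incl : IntermediateField.adjoin (henselization V K) (Set.range (ι ∘ b)) →+*
      algebraicClosure K Ω :=
    (algebraMap _ Ω).codRestrict (algebraicClosure K Ω) (coe_adjoin_mem_algebraicClosure V K b ι)
  let f : IntermediateField.adjoin (henselization V K) (Set.range (ι ∘ b)) →+* Ω :=
    (algebraMap (algebraicClosure K Ω) Ω).comp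
      ((σ : algebraicClosure K Ω →+* algebraicClosure K Ω).comp incl)
  have hf : ∀ m, f m = ((σ ⟨(m : Ω), coe_adjoin_mem_algebraicClosure V K b ι m⟩ :
      algebraicClosure K Ω) : Ω) := fun _ => rfl
  refine ⟨{ toRingHom := f, commutes' := fun c => ?_ }, fun y => ?_⟩
  · change f (algebraMap (henselization V K) _ c) = _
    rw [hf, hσfix _ c.2]
    rfl
  · change f ⟨ι y, _⟩ = ι' y
    rw [hf]
    exact hσ y

/-- Conversely, a `K^h`-embedding `φ` of `K^h(ι(L))` gives a `K`-embedding `φ ∘ ι` of `L`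
inducing the SAME valuation ring as `ι` (it extends to an automorphism of `K̃` fixing
`K^h`, which preserves `V ∩ K̃`). PROVED. [cite: Kuhlmann2010, Section 1.1] -/
theorem algHom_adjoin_apply_mem_iff [FiniteDimensional K L] (ι : L →ₐ[K] Ω)
    (φ : IntermediateField.adjoin (henselization V K) (Set.range (ι ∘ b))
      →ₐ[henselization V K] Ω) (y : L) :
    φ ⟨ι y, algHom_apply_mem_adjoin V K b ι y⟩ ∈ V ↔ ι y ∈ V := by
  haveI : IsAlgClosed (algebraicClosure K Ω) := IsAlgClosure.isAlgClosed K
  haveI := finiteDimensional_adjoin_henselization V K b ι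
  haveI := isAlgebraic_henselization V K
  have hmemφ : ∀ m, φ m ∈ algebraicClosure K Ω := fun m =>
    mem_algebraicClosure_iff.mpr
      (((Algebra.IsAlgebraic.isAlgebraic (R := henselization V K) m).algHom φ).restrictScalars K)
  let φA : IntermediateField.adjoin (henselization V K) (Set.range (ι ∘ b)) →ₐ[K]
      algebraicClosure K Ω :=
    AlgHom.codRestrict (φ.restrictScalars K) (algebraicClosure K Ω).toSubalgebra hmemφ
  let inclA : IntermediateField.adjoin (henselization V K) (Set.range (ι ∘ b)) →ₐ[K]
      algebraicClosure K Ω :=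
    AlgHom.codRestrict ((IsScalarTower.toAlgHom (henselization V K) _ Ω).restrictScalars K)
      (algebraicClosure K Ω).toSubalgebra (coe_adjoin_mem_algebraicClosure V K b ι)
  obtain ⟨τ, hτ⟩ := exists_algEquiv_comp_eq inclA φA
  have hτfix : ∀ x : algebraicClosure K Ω, (x : Ω) ∈ henselization V K → τ x = x := by
    intro x hx
    have hxM : (x : Ω) ∈ IntermediateField.adjoin (henselization V K) (Set.range (ι ∘ b)) :=
      IntermediateField.algebraMap_mem _ (⟨x, hx⟩ : henselization V K)
    have h1 : x = inclA ⟨x, hxM⟩ := Subtype.ext rfl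
    rw [h1, hτ]
    apply Subtype.ext
    change φ ⟨x, hxM⟩ = (x : Ω)
    exact φ.commutes (⟨x, hx⟩ : henselization V K)
  have hstab := (smul_comap_algebraicClosure_eq_iff V K τ).mpr hτfix
  rw [smul_valuationSubring_eq_self_iff] at hstab
  have := hstab (inclA ⟨ι y, algHom_apply_mem_adjoin V K b ι y⟩)
  rw [hτ] at this
  exact this

omit [IsAlgClosed Ω] in
/-- A `K^h`-embedding of `K^h(ι(L))` is determined by its values on `ι(L)`. [folklore] -/
theorem algHom_adjoin_ext (ι : L →ₐ[K] Ω)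
    {φ₁ φ₂ : IntermediateField.adjoin (henselization V K) (Set.range (ι ∘ b))
      →ₐ[henselization V K] Ω}
    (h : ∀ y : L, φ₁ ⟨ι y, algHom_apply_mem_adjoin V K b ι y⟩ =
      φ₂ ⟨ι y, algHom_apply_mem_adjoin V K b ι y⟩) : φ₁ = φ₂ := by
  refine IntermediateField.adjoin_algHom_ext _ fun x hx => ?_
  obtain ⟨i, rfl⟩ := hx
  exact h _

/-- **The `K`-embeddings of `L` inducing a given valuation ring correspond to the
`K^h`-embeddings of `K^h(ι(L))`**: `#{ι' : ι'⁻¹(V) = ι⁻¹(V)} = #Hom_{K^h}(K^h(ι(L)), Ω)`.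
PROVED. [cite: Kuhlmann2010, Section 1.1] -/
theorem natCard_fiber_eq_natCard_algHom [FiniteDimensional K L] (ι : L →ₐ[K] Ω) :
    Nat.card {ι' : L →ₐ[K] Ω // V.comap ι'.toRingHom = V.comap ι.toRingHom} =
      Nat.card (IntermediateField.adjoin (henselization V K) (Set.range (ι ∘ b))
        →ₐ[henselization V K] Ω) := by
  let ιM : L →ₐ[K] IntermediateField.adjoin (henselization V K) (Set.range (ι ∘ b)) :=
    AlgHom.codRestrict ι (IntermediateField.restrictScalars K
      (IntermediateField.adjoin (henselization V K) (Set.range (ι ∘ b)))).toSubalgebra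
      (algHom_apply_mem_adjoin V K b ι)
  let Φ : (IntermediateField.adjoin (henselization V K) (Set.range (ι ∘ b))
      →ₐ[henselization V K] Ω) →
      {ι' : L →ₐ[K] Ω // V.comap ι'.toRingHom = V.comap ι.toRingHom} :=
    fun φ => ⟨(φ.restrictScalars K).comp ιM, by
      ext y
      rw [ValuationSubring.mem_comap, ValuationSubring.mem_comap]
      exact algHom_adjoin_apply_mem_iff V K b ι φ y⟩
  have hΦ : ∀ φ y, (Φ φ : L →ₐ[K] Ω) y = φ ⟨ι y, algHom_apply_mem_adjoin V K b ι y⟩ :=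
    fun _ _ => rfl
  symm
  refine Nat.card_eq_of_bijective Φ ⟨fun φ₁ φ₂ h12 => ?_, fun ι' => ?_⟩
  · refine algHom_adjoin_ext V K b ι fun y => ?_
    rw [← hΦ, ← hΦ, h12]
  · obtain ⟨φ, hφ⟩ := exists_algHom_adjoin_apply_eq V K b ι ι' ι'.2.symm
    refine ⟨φ, Subtype.ext (AlgHom.ext fun y => ?_)⟩
    rw [hΦ, hφ]

end Compositum

/-! ### Degrees: `[K^h(ι(L)) : K^h] = #Hom_{K^h}(K^h(ι(L)), Ω) · [L : K]_i` -/

section Degrees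

variable {Ω : Type u} [Field Ω] [IsAlgClosed Ω] (V : ValuationSubring Ω) (K : Subfield Ω)
variable {L : Type u} [Field L] [Algebra K L] {n : ℕ} (b : Module.Basis (Fin n) K L)

omit [IsAlgClosed Ω] in
/-- `K^h / K` is separable (Lemma 2.2: `K^h|K` is "separable-algebraic"). PROVED.
[cite: Kuhlmann2010, Lemma 2.2] -/
theorem isSeparable_henselization : Algebra.IsSeparable K (henselization V K) := by
  refine ⟨fun x => ?_⟩
  rw [← isSeparable_map_iff (IsScalarTower.toAlgHom K (henselization V K) Ω)
    Subtype.val_injective]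
  exact isSeparable_of_mem_henselization V K x.2

omit [IsAlgClosed Ω] in
/-- **The inseparable degree is unchanged**: `[K^h(ι(L)) : K^h]_i = [L : K]_i` (because
`K^h / K` is separable and `K^h(ι(L)) / ι(L)` is separable). PROVED. [folklore] -/
theorem finInsepDegree_adjoin_eq [FiniteDimensional K L] (ι : L →ₐ[K] Ω) :
    Field.finInsepDegree (henselization V K)
        (IntermediateField.adjoin (henselization V K) (Set.range (ι ∘ b))) =
      Field.finInsepDegree K L := by
  haveI := isSeparable_henselization V K
  -- `[M : K]_i = [M : K^h]_i`
  have h1 : Field.finInsepDegree K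
      (IntermediateField.adjoin (henselization V K) (Set.range (ι ∘ b))) =
      Field.finInsepDegree (henselization V K)
        (IntermediateField.adjoin (henselization V K) (Set.range (ι ∘ b))) := by
    rw [Field.finInsepDegree_def', Field.finInsepDegree_def',
      Field.insepDegree_eq_of_isSeparable K (henselization V K)]
  rw [← h1]
  -- the tower `K → ι(L) → M`
  let F : IntermediateField K Ω := ι.fieldRange
  have hFM : ∀ x : F,
      (x : Ω) ∈ IntermediateField.adjoin (henselization V K) (Set.range (ι ∘ b)) := by
    rintro ⟨_, y, rfl⟩
    exact algHom_apply_mem_adjoin V K b ι y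
  letI : Algebra F (IntermediateField.adjoin (henselization V K) (Set.range (ι ∘ b))) :=
    ((algebraMap F Ω).codRestrict _ hFM).toAlgebra
  haveI : IsScalarTower K F (IntermediateField.adjoin (henselization V K) (Set.range (ι ∘ b))) :=
    IsScalarTower.of_algebraMap_eq fun _ => rfl
  haveI : IsScalarTower F
      (IntermediateField.adjoin (henselization V K) (Set.range (ι ∘ b))) Ω :=
    IsScalarTower.of_algebraMap_eq fun _ => rfl
  let e : L ≃ₐ[K] F := AlgEquiv.ofInjectiveField ι
  haveI : FiniteDimensional K F := LinearEquiv.finiteDimensional e.toLinearEquiv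
  haveI : Algebra.IsAlgebraic K F := Algebra.IsAlgebraic.of_finite K F
  have h2 := Field.finInsepDegree_mul_finInsepDegree_of_isAlgebraic K F
    (IntermediateField.adjoin (henselization V K) (Set.range (ι ∘ b)))
  -- `M / ι(L)` is separable: `M ⊆ (ι(L))^{sep}`
  haveI : Algebra.IsSeparable F
      (IntermediateField.adjoin (henselization V K) (Set.range (ι ∘ b))) := by
    have hle : (IntermediateField.adjoin (henselization V K) (Set.range (ι ∘ b))).toSubfield ≤
        (separableClosure F Ω).toSubfield := by
      rw [IntermediateField.adjoin_toSubfield, Subfield.closure_le]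
      rintro x (⟨c, rfl⟩ | ⟨i, rfl⟩)
      · exact mem_separableClosure_iff.mpr
          ((isSeparable_of_mem_henselization V K c.2).tower_top F)
      · refine mem_separableClosure_iff.mpr ?_
        change IsSeparable F (ι (b i))
        have : ι (b i) = algebraMap F Ω (e (b i)) := rfl
        rw [this]
        exact isSeparable_algebraMap _
    refine ⟨fun m => ?_⟩
    have hm : (m : Ω) ∈ separableClosure F Ω := hle m.2
    rw [← isSeparable_map_iff (IsScalarTower.toAlgHom F _ Ω) Subtype.val_injective]
    exact mem_separableClosure_iff.mp hm
  have h3 : Field.finInsepDegree F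
      (IntermediateField.adjoin (henselization V K) (Set.range (ι ∘ b))) = 1 :=
    (isSeparable_iff_finInsepDegree_eq_one F _).mp inferInstance
  rw [h3, mul_one, ← Field.finInsepDegree_eq_of_equiv _ _ _ e] at h2
  exact h2.symm

/-- **`[K^h(ι(L)) : K^h] = #Hom_{K^h}(K^h(ι(L)), Ω) · [L : K]_i`.** PROVED. [folklore] -/
theorem finrank_adjoin_eq [FiniteDimensional K L] (ι : L →ₐ[K] Ω) :
    Module.finrank (henselization V K)
        (IntermediateField.adjoin (henselization V K) (Set.range (ι ∘ b))) =
      Nat.card (IntermediateField.adjoin (henselization V K) (Set.range (ι ∘ b))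
        →ₐ[henselization V K] Ω) * Field.finInsepDegree K L := by
  haveI := finiteDimensional_adjoin_henselization V K b ι
  rw [← finInsepDegree_adjoin_eq V K b ι, ← Field.finSepDegree_eq_of_isAlgClosed _ _ Ω,
    Field.finSepDegree_mul_finInsepDegree]

/-- **The degree formula** (the heart of [En] (18.2) / Kuhlmann 2010, Thm. 2.14): if `s` is the
(finite) set of extensions of `V ∩ K` to `L` and `ι_{O'}` is a `K`-embedding of `L` into `Ω`
inducing `O' ∈ s`, then `∑_{O' ∈ s} [K^h(ι_{O'}(L)) : K^h] = [L : K]`. PROVED by counting the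
`K`-embeddings of `L` into `Ω` (`[L : K]_s` of them) according to the valuation ring they
induce. [cite: Kuhlmann2010, Thm. 2.14] -/
theorem sum_finrank_adjoin_eq_finrank [FiniteDimensional K L] (s : Finset (ValuationSubring L))
    (hs : ∀ O' : ValuationSubring L,
      O' ∈ s ↔ O'.comap (algebraMap K L) = V.comap (algebraMap K Ω))
    (rep : ValuationSubring L → (L →ₐ[K] Ω))
    (hrep : ∀ O' ∈ s, V.comap (rep O').toRingHom = O') :
    ∑ O' ∈ s, Module.finrank (henselization V K)
        (IntermediateField.adjoin (henselization V K) (Set.range (rep O' ∘ b))) =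
      Module.finrank K L := by
  classical
  have hmaps : ((Finset.univ : Finset (L →ₐ[K] Ω)) : Set (L →ₐ[K] Ω)).MapsTo
      (fun ι => V.comap ι.toRingHom) s := by
    intro ι _
    rw [Finset.mem_coe, hs]
    ext c
    change ι (algebraMap K L c) ∈ V ↔ (c : Ω) ∈ V
    rw [ι.commutes]
    rfl
  have hcard := Finset.card_eq_sum_card_fiberwise hmaps
  have hfib : ∀ O' ∈ s,
      (Finset.univ.filter fun ι : L →ₐ[K] Ω => V.comap ι.toRingHom = O').card
      * Field.finInsepDegree K L = Module.finrank (henselization V K)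
        (IntermediateField.adjoin (henselization V K) (Set.range (rep O' ∘ b))) := by
    intro O' hO'
    rw [finrank_adjoin_eq V K b (rep O'), ← natCard_fiber_eq_natCard_algHom V K b (rep O'),
      hrep O' hO', Nat.card_eq_fintype_card, Fintype.card_subtype]
  conv_rhs => rw [← Field.finSepDegree_mul_finInsepDegree K L,
    Field.finSepDegree_eq_of_isAlgClosed K L Ω, Nat.card_eq_fintype_card, ← Finset.card_univ,
    hcard, Finset.sum_mul]
  exact (Finset.sum_congr rfl hfib).symm

end Degrees

end Literature.AlgebraicGeometry.Resolution
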